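import Summits.CriticalPhenomena.PercolationContinuityZ3.Theorems.PercNearOneGluingNoHeavyLowerTailSunflowerDisjointKernelPair
import HarnessLib
import HarnessLib.Audit

/-!
# `NoHeavyLowerTail` (crux stmt-CriticalPhenomena-4575), abstract sunflower cubic: ★ FROM A LOCAL (cube-by-cube) ASSIGNMENT OF THE RAINBOWS —
# the block rank bound, and the unconditional class "rival-free bottom slots + private kernel supplies"

Support file (seat `prim-l12-p2` gen 24; `--supports stmt-CriticalPhenomena-4575`).  No `sorry`, no new definitions.
Memo: run/shared/lean/prim/prim-l12/prim-l12-p2/FINDING-g24-LOCAL-ASSIGNMENT.md.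

SETTING (gens 18–23).  ★ (`PartitionLemmaH`) reads `#rainbows ≤ Σ_{lab S ∈ {0,4}} cubeSlack Sᶜ` (`ZH_eq_six_slack`); the two-stage vector `rbVec ρ`
of a rainbow `ρ = (Q1,Q2,Q3)` lives on the supplies `σ = (X,S,Y)` and, on the block of supplies with spectator `S`, lies in the kernel of the
spectator rows of the cube `Sᶜ` (`rbVec_orth`).  `RainbowKernelIndependence` (global independence) and `RainbowMatroidPartition` (two classes)
both imply ★ by rank–nullity.  THIS FILE localises the count to single cubes:

* `Sunflower.card_le_cubeSlack_of_blockIndependent` — BLOCK RANK BOUND: if `R` is a set of rainbows whose vectors RESTRICTED TO THE SUPPLIES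
  WITH SPECTATOR EXACTLY `S` are linearly independent over `GF(2)`, then `#R ≤ cubeSlack Sᶜ` (rank–nullity inside the one cube `Sᶜ`:
  `card_sup_fiber`, `card_dem_spec_fiber`, `specRows_indep`, `rbVec_orth`).
* `Sunflower.ZH_nonneg_of_blockAssignment` — ★ for every sunflower admitting a map `f : rainbows → blocks` (`lab (f ρ) ∈ {0,4}`) such that for
  every block `S` the fibre `f⁻¹(S)`, restricted to the `S`-supplies, is independent ("LOCAL MATROID PARTITION": independence is only required
  cube by cube; by the generalised Laplace expansion it is implied by `RainbowKernelIndependence` and by `RainbowMatroidPartition`, hence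
  census-clean wherever those are; it is Rado's condition `#X ≤ Σ_S rank_S(X)` for the direct sum of the per-cube linear matroids).
* TWO LOCAL INDEPENDENCE CRITERIA.  `Sunflower.blockIndependent_of_rivalFree`: at a BOTTOM block `S`, rainbows with pairwise distinct `Q1`,
  each having `S` as a slot (`S ⊆ Q3`, `lab (Sᶜ∖Q1) = 4`, `#{R' ∈ B : S ⊆ R' ⊆ Q3}` odd) and `Q1` RIVAL-FREE in the cube `Sᶜ` (no label-1
  `T ⊆ Sᶜ∖Q1` with `lab (Sᶜ∖T) = 4`), are independent there — the UP-READER `Λ_{Q1}` (`nu_read_up`, gen 23) of the `⊆`-maximal `Q1` in a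
  dependency reads it off (`rbVec_pair_bottom_raw`).  `Sunflower.blockIndependent_of_private`: at any block, rainbows with pairwise PRIVATE
  supplies are independent.
* **`Sunflower.ZH_nonneg_of_goodAssignment`** (NEW UNCONDITIONAL CLASS): if the rainbows can be assigned injectively to rival-free bottom slots
  `(S, Q1)` and to kernel blocks carrying a private supply, then `0 ≤ ZH`.  Gen 23's class (no two disjoint petal-1 sets with kernel complements)
  makes EVERY bottom slot rival-free; here rival-freeness is asked only in the cubes actually used — deep slots `S = Q3∖e` have small cubes
  `Q1 ∪ Q2 ∪ {e}` with few rivals.  CENSUS (gen 24, `code/gsm3.c`, fixed petal order): such an assignment exists in 780/780 (n = 4, all), 8 040/8 040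
  (random n = 5), 2 134/2 156 (random n = 6), 3 000/3 000 resp. 535/600 ('hard' all-petals-non-intersecting n = 6 resp. 7; gen 23's hypothesis: 82/3 000
  at n = 7) and for the doubled star (all eight rainbows on private kernel supplies); the unrestricted local assignment exists in every instance tested
  (n ≤ 4 exhaustive, 2·10⁴ random n ≤ 6, 5 000 hard n ≤ 7; `code/lmp.c`, exact matroid intersection).
-/

namespace Summit.CriticalPhenomena.PercolationContinuityZ3.Theorems.SunflowerPartition

open Finset

variable {α : Type*} [Fintype α] [DecidableEq α]

namespace Sunflower

variable (F : Sunflower α)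

/-! ## The block rank bound -/

/-- **BLOCK RANK BOUND** (this work).  Let `lab S ∈ {0,4}` and let `R` be a set of rainbows whose two-stage vectors, restricted to the supplies
with spectator block exactly `S`, are linearly independent over `GF(2)`.  Then `#R ≤ cubeSlack Sᶜ`: the spectator rows of the cube `Sᶜ` are
independent (`specRows_indep`) and number `#CR(Sᶜ)` (`card_dem_spec_fiber`), the restricted rainbow vectors lie in their kernel (`rbVec_orth`),
and the block has `#AB(Sᶜ)` supplies (`card_sup_fiber`). [this work] -/
theorem card_le_cubeSlack_of_blockIndependent (S : Finset α) (hS : F.lab S = 4 ∨ F.lab S = 0) (R : Finset (Finset α × Finset α))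
    (hR : R ⊆ F.dem.filter (fun d => F.IsRainbow d))
    (hli : LinearIndependent (ZMod 2)
      (fun ρ : ↥R => fun σ : ↥(F.sup.filter (fun σ => σ.2 = S)) => F.rbVec ρ.1 σ.1)) :
    (R.card : ℤ) ≤ F.cubeSlack Sᶜ := by
  classical
  set supV := F.sup.filter (fun σ => σ.2 = S) with hsupV
  set SPV := (F.dem.filter (fun d => ¬ F.IsRainbow d)).filter (fun d => d.1 = S) with hSPV
  let Rm : Matrix ↥SPV ↥supV (ZMod 2) := Matrix.of fun d σ => F.specRow d.1 σ.1
  -- (1) the rows of `Rm` are independent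
  have hinj : Function.Injective (Matrix.mulVecLin Rm.transpose) := by
    rw [← LinearMap.ker_eq_bot, LinearMap.ker_eq_bot']
    intro g hg
    let c : Finset α × Finset α → ZMod 2 := fun d => if hd : d ∈ SPV then g ⟨d, hd⟩ else 0
    have hc : ∀ σ ∈ F.sup, (∑ d ∈ F.dem.filter (fun d => ¬ F.IsRainbow d), c d * F.specRow d σ) = 0 := by
      intro σ hσ
      have hsplit : (∑ d ∈ F.dem.filter (fun d => ¬ F.IsRainbow d), c d * F.specRow d σ) = ∑ d ∈ SPV, c d * F.specRow d σ := by
        symm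
        refine Finset.sum_subset (by rw [hSPV]; exact Finset.filter_subset _ _) fun d _ hdn => ?_
        simp only [c, dif_neg hdn, zero_mul]
      rw [hsplit]
      by_cases hσV : σ ∈ supV
      · have h0 : (Rm.transpose.mulVec g) ⟨σ, hσV⟩ = 0 :=
          congrFun (show Rm.transpose.mulVec g = 0 from (Matrix.mulVecLin_apply Rm.transpose g).symm.trans hg) ⟨σ, hσV⟩
        simp only [Matrix.mulVec, dotProduct, Matrix.transpose_apply, Rm, Matrix.of_apply] at h0
        rw [← Finset.sum_coe_sort SPV]
        refine Eq.trans (sum_congr rfl fun x _ => ?_) h0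
        simp only [c, dif_pos x.2]
        ring
      · refine sum_eq_zero fun d hd => ?_
        have hdv : d.1 = S := (mem_filter.1 hd).2
        have hne : σ.2 ≠ d.1 := fun h => hσV (mem_filter.2 ⟨hσ, by rw [h, hdv]⟩)
        unfold specRow
        rw [if_neg hne, mul_zero]
    have hz := F.specRows_indep c hc
    funext x
    have := hz x.1 (mem_filter.1 x.2).1
    simp only [c, dif_pos x.2] at this
    rw [this, Pi.zero_apply]
  -- (2) rank of the row map
  have hrank : Module.finrank (ZMod 2) (LinearMap.range (Matrix.mulVecLin Rm)) = Fintype.card ↥SPV := by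
    have h1 : Rm.rank = Rm.transpose.rank := (Matrix.rank_transpose Rm).symm
    unfold Matrix.rank at h1
    rw [h1, LinearMap.finrank_range_of_inj hinj, Module.finrank_fintype_fun_eq_card]
  -- (3) the restricted rainbow vectors lie in the kernel
  have hker : Submodule.span (ZMod 2) (Set.range (fun ρ : ↥R => fun σ : ↥supV => F.rbVec ρ.1 σ.1))
      ≤ LinearMap.ker (Matrix.mulVecLin Rm) := by
    rw [Submodule.span_le]
    rintro w ⟨ρ, rfl⟩
    rw [SetLike.mem_coe, LinearMap.mem_ker, Matrix.mulVecLin_apply]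
    funext d
    simp only [Matrix.mulVec, dotProduct, Rm, Matrix.of_apply, Pi.zero_apply]
    have hρ : ρ.1 ∈ F.dem.filter (fun d => F.IsRainbow d) := hR ρ.2
    have horth := F.rbVec_orth (mem_filter.1 hρ).1 (mem_filter.1 hρ).2 (mem_filter.1 (mem_filter.1 d.2).1).1
      (mem_filter.1 (mem_filter.1 d.2).1).2
    have hdv : d.1.1 = S := (mem_filter.1 d.2).2
    have hrestr : (∑ σ ∈ F.sup, F.specRow d.1 σ * F.rbVec ρ.1 σ) = ∑ σ ∈ supV, F.specRow d.1 σ * F.rbVec ρ.1 σ := by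
      rw [hsupV, Finset.sum_filter]
      refine sum_congr rfl fun σ _ => ?_
      by_cases h : σ.2 = S
      · rw [if_pos h]
      · rw [if_neg h]
        have hne : σ.2 ≠ d.1.1 := fun h' => h (by rw [h', hdv])
        unfold specRow
        rw [if_neg hne, zero_mul]
    rw [hrestr, ← Finset.sum_coe_sort supV] at horth
    exact horth
  -- (4) count dimensions
  have hT : Module.finrank (ZMod 2)
      (Submodule.span (ZMod 2) (Set.range (fun ρ : ↥R => fun σ : ↥supV => F.rbVec ρ.1 σ.1))) = Fintype.card ↥R :=
    finrank_span_eq_card hli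
  have hrn := LinearMap.finrank_range_add_finrank_ker (Matrix.mulVecLin Rm)
  rw [Module.finrank_fintype_fun_eq_card, hrank] at hrn
  have hle := Submodule.finrank_mono hker
  rw [hT] at hle
  have hcards : Fintype.card ↥SPV + Fintype.card ↥R ≤ Fintype.card ↥supV := by omega
  rw [Fintype.card_coe, Fintype.card_coe, Fintype.card_coe] at hcards
  rw [hSPV, F.card_dem_spec_fiber S, if_pos hS, hsupV, F.card_sup_fiber S, if_pos hS] at hcards
  unfold cubeSlack
  have : ((F.crCard Sᶜ + R.card : ℕ) : ℤ) ≤ ((F.abCard Sᶜ : ℕ) : ℤ) := by exact_mod_cast hcards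
  push_cast at this
  linarith

/-! ## ★ from a block assignment with independent fibres ("local matroid partition") -/

/-- **★ FROM A LOCAL ASSIGNMENT** (this work).  If the rainbows are assigned to spectator blocks `f ρ` (`lab (f ρ) ∈ {0,4}`) so that every fibre
`{ρ : f ρ = S}`, restricted to the supplies with spectator `S`, is linearly independent over `GF(2)`, then `0 ≤ ZH`:  `#rainbows = Σ_S #f⁻¹(S)
≤ Σ_{lab S ∈ {0,4}} cubeSlack Sᶜ` (block rank bound) and `ZH = 6·(Σ cubeSlack − #rainbows)` (`ZH_eq_six_slack`). [this work] -/
theorem ZH_nonneg_of_blockAssignment (f : Finset α × Finset α → Finset α)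
    (hf : ∀ ρ ∈ F.dem.filter (fun d => F.IsRainbow d), F.lab (f ρ) = 4 ∨ F.lab (f ρ) = 0)
    (hind : ∀ S : Finset α, (F.lab S = 4 ∨ F.lab S = 0) → LinearIndependent (ZMod 2)
      (fun ρ : ↥((F.dem.filter (fun d => F.IsRainbow d)).filter (fun ρ => f ρ = S)) =>
        fun σ : ↥(F.sup.filter (fun σ => σ.2 = S)) => F.rbVec ρ.1 σ.1)) :
    0 ≤ F.ZH := by
  classical
  -- `#rainbows = Σ_S #fibre(S)` over the blocks with label in `{0,4}`
  have hfib : F.rainbowCard = ∑ S ∈ (Finset.univ : Finset (Finset α)).filter (fun S => F.lab S = 4 ∨ F.lab S = 0),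
      ((F.dem.filter (fun d => F.IsRainbow d)).filter (fun ρ => f ρ = S)).card := by
    unfold rainbowCard
    rw [Finset.card_eq_sum_card_fiberwise (f := f) (t := (Finset.univ : Finset (Finset α)).filter (fun S => F.lab S = 4 ∨ F.lab S = 0))
      (fun ρ hρ => mem_coe.2 (mem_filter.2 ⟨mem_univ _, hf ρ hρ⟩))]
  -- each fibre is bounded by the slack of its cube
  have hle : ∀ S ∈ (Finset.univ : Finset (Finset α)).filter (fun S => F.lab S = 4 ∨ F.lab S = 0),
      ((((F.dem.filter (fun d => F.IsRainbow d)).filter (fun ρ => f ρ = S)).card : ℕ) : ℤ) ≤ F.cubeSlack Sᶜ := by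
    intro S hS
    have hS' := (mem_filter.1 hS).2
    exact F.card_le_cubeSlack_of_blockIndependent S hS' _ (Finset.filter_subset _ _) (hind S hS')
  have hsum : (F.rainbowCard : ℤ) ≤ ∑ S ∈ (Finset.univ : Finset (Finset α)).filter (fun S => F.lab S = 4 ∨ F.lab S = 0), F.cubeSlack Sᶜ := by
    rw [hfib]
    push_cast
    exact Finset.sum_le_sum hle
  have hsplit : (∑ S ∈ (Finset.univ : Finset (Finset α)).filter (fun S => F.lab S = 4 ∨ F.lab S = 0), F.cubeSlack Sᶜ)
      = (∑ S ∈ (Finset.univ : Finset (Finset α)).filter (fun S => F.lab S = 0), F.cubeSlack Sᶜ)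
        + ∑ S ∈ (Finset.univ : Finset (Finset α)).filter (fun S => F.lab S = 4), F.cubeSlack Sᶜ := by
    rw [Finset.filter_or, Finset.sum_union, add_comm]
    exact Finset.disjoint_filter.2 fun S _ h4 h0 => by rw [h4] at h0; exact absurd h0 (by decide)
  rw [F.ZH_eq_six_slack]
  rw [hsplit] at hsum
  linarith

/-! ## Two local independence criteria -/

/-- **PRIVATE SUPPLIES** (this work).  At any block `S`, a set `R` of rainbows each of which has a supply with spectator `S` where its own vector
is nonzero and the vectors of all other members of `R` vanish is independent there. [this work] -/
theorem blockIndependent_of_private (S : Finset α) (R : Finset (Finset α × Finset α))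
    (hpriv : ∀ ρ ∈ R, ∃ σ ∈ F.sup, σ.2 = S ∧ F.rbVec ρ σ ≠ 0 ∧ ∀ ρ' ∈ R, ρ' ≠ ρ → F.rbVec ρ' σ = 0) :
    LinearIndependent (ZMod 2) (fun ρ : ↥R => fun σ : ↥(F.sup.filter (fun σ => σ.2 = S)) => F.rbVec ρ.1 σ.1) := by
  classical
  rw [Fintype.linearIndependent_iff]
  intro g hg i
  obtain ⟨σ, hσ, hσS, hnz, hoth⟩ := hpriv i.1 i.2
  have h := congrFun hg ⟨σ, mem_filter.2 ⟨hσ, hσS⟩⟩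
  simp only [Finset.sum_apply, Pi.smul_apply, smul_eq_mul, Pi.zero_apply] at h
  rw [← Finset.sum_erase_add _ _ (mem_univ i)] at h
  rw [show (∑ j ∈ (Finset.univ : Finset ↥R).erase i, g j * F.rbVec j.1 σ) = 0 from
    sum_eq_zero fun j hj => by
      rw [hoth j.1 j.2 (fun e => (mem_erase.1 hj).1 (Subtype.ext e)), mul_zero], zero_add] at h
  rcases mul_eq_zero.1 h with h1 | h1
  · exact h1
  · exact absurd h1 hnz

/-- **RIVAL-FREE BOTTOM SLOTS** (this work).  Let `lab S = 0` and let `R` be a set of rainbows `ρ = (Q1,Q2,Q3)` with pairwise distinct `Q1`, each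
having `S` as a SLOT — `S ⊆ Q3`, `lab (Sᶜ ∖ Q1) = 4`, `#{R' ∈ B : S ⊆ R' ⊆ Q3}` odd — with `Q1` RIVAL-FREE in the cube `Sᶜ` (no `T ⊆ Sᶜ ∖ Q1` with
`lab T = 1`, `lab (Sᶜ∖T) = 4`).  Then the vectors `rbVec ρ`, `ρ ∈ R`, restricted to the supplies with spectator `S`, are linearly independent:
in a dependency take `ρ*` with `|Q1|` maximal; the up-reader `Λ_{Q1ρ*}` of the cube `Sᶜ` at the slice `S` reads `rbVec ρ` as
`[slot]·#{R' ∈ B : S ⊆ R' ⊆ Q3ρ}·[Q1ρ* ⊆ Q1ρ]` (`rbVec_pair_bottom_raw`, `nu_read_up`), which is the coefficient of `ρ*` alone. [this work] -/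
theorem blockIndependent_of_rivalFree {S : Finset α} (hS0 : F.lab S = 0) (R : Finset (Finset α × Finset α))
    (hR : R ⊆ F.dem.filter (fun d => F.IsRainbow d))
    (hslot : ∀ ρ ∈ R, S ⊆ (ρ.1 ∪ ρ.2)ᶜ ∧ F.lab (Sᶜ \ ρ.1) = 4 ∧
      (∑ R' ∈ (Finset.univ : Finset α).powerset, (if F.lab R' = 0 ∧ S ⊆ R' ∧ R' ⊆ (ρ.1 ∪ ρ.2)ᶜ then (1 : ZMod 2) else 0)) = 1 ∧
      ∀ T, T ⊆ Sᶜ \ ρ.1 → F.lab T = 1 → F.lab (Sᶜ \ T) ≠ 4)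
    (hinj : ∀ ρ ∈ R, ∀ ρ' ∈ R, ρ.1 = ρ'.1 → ρ = ρ') :
    LinearIndependent (ZMod 2) (fun ρ : ↥R => fun σ : ↥(F.sup.filter (fun σ => σ.2 = S)) => F.rbVec ρ.1 σ.1) := by
  classical
  rw [Fintype.linearIndependent_iff]
  intro g hg
  by_contra hne
  push Not at hne
  obtain ⟨i₀, hi₀⟩ := hne
  have rfacts : ∀ i : ↥R, i.1 ∈ F.dem ∧ F.IsRainbow i.1 := fun i => ⟨(mem_filter.1 (hR i.2)).1, (mem_filter.1 (hR i.2)).2⟩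
  -- evaluation of the dependency at a supply of the block
  have hsum : ∀ σ ∈ F.sup, σ.2 = S → (∑ i : ↥R, g i * F.rbVec i.1 σ) = 0 := by
    intro σ hσ hσS
    have h := congrFun hg ⟨σ, mem_filter.2 ⟨hσ, hσS⟩⟩
    simp only [Finset.sum_apply, Pi.smul_apply, smul_eq_mul, Pi.zero_apply] at h
    exact h
  -- the maximal `Q1` in the support
  obtain ⟨s, hsT, hmax⟩ := Finset.exists_max_image ((Finset.univ : Finset ↥R).filter (fun i => g i ≠ 0))
    (fun i : ↥R => i.1.1.card) ⟨i₀, mem_filter.2 ⟨mem_univ _, hi₀⟩⟩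
  have hgs : g s ≠ 0 := (mem_filter.1 hsT).2
  obtain ⟨hSs, hS4, hPhi, H⟩ := hslot s.1 s.2
  have hPS : s.1.1 ⊆ Sᶜ := by
    intro x hx; rw [mem_compl]; intro hxS
    have := hSs hxS; rw [mem_compl, mem_union, not_or] at this; exact this.1 hx
  -- per-rainbow reading of the functional `Λ_{Q1 s}` (raw pairing + up-reader)
  have hread : ∀ i : ↥R, (∑ Y ∈ (Sᶜ \ s.1.1).powerset, (if F.lab (Sᶜ \ Y) = 4 then
      ∑ σ ∈ F.sup, (if σ.2 = S then
        (∑ R' ∈ (Sᶜ).powerset, (if F.lab R' = 0 ∧ (σ.1 ∪ σ.2)ᶜ ⊆ R' ∧ R' ⊆ Y then (1 : ZMod 2) else 0)) * F.rbVec i.1 σ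
        else 0) else 0))
      = (if F.lab S = 0 ∧ S ⊆ (i.1.1 ∪ i.1.2)ᶜ ∧ F.lab (Sᶜ \ i.1.1) = 4 then
          (∑ R' ∈ (Finset.univ : Finset α).powerset, (if F.lab R' = 0 ∧ S ⊆ R' ∧ R' ⊆ (i.1.1 ∪ i.1.2)ᶜ then (1 : ZMod 2) else 0))
          else 0) * (if s.1.1 ⊆ i.1.1 then 1 else 0) := by
    intro i
    obtain ⟨hid, hir⟩ := rfacts i
    by_cases hc : F.lab S = 0 ∧ S ⊆ (i.1.1 ∪ i.1.2)ᶜ ∧ F.lab (Sᶜ \ i.1.1) = 4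
    · rw [if_pos hc]
      have hQ1S : i.1.1 ⊆ Sᶜ := by
        intro x hx; rw [mem_compl]; intro hxS
        have := hc.2.1 hxS; rw [mem_compl, mem_union, not_or] at this; exact this.1 hx
      rw [← F.nu_read_up Sᶜ hPS hQ1S hS4 (F.dem_rainbow_facts hid hir).2.1 H, Finset.mul_sum]
      refine sum_congr rfl fun Y hY => ?_
      have hYS : Y ⊆ Sᶜ := (mem_powerset.1 hY).trans sdiff_subset
      by_cases hY4 : F.lab (Sᶜ \ Y) = 4
      · rw [if_pos hY4, if_pos hY4, F.rbVec_pair_bottom_raw hid hir hS0 hYS, if_pos hc]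
      · rw [if_neg hY4, if_neg hY4, mul_zero]
    · rw [if_neg hc, zero_mul]
      refine sum_eq_zero fun Y hY => ?_
      have hYS : Y ⊆ Sᶜ := (mem_powerset.1 hY).trans sdiff_subset
      by_cases hY4 : F.lab (Sᶜ \ Y) = 4
      · rw [if_pos hY4, F.rbVec_pair_bottom_raw hid hir hS0 hYS, if_neg hc]
      · rw [if_neg hY4]
  -- linearity: the functional applied to the dependency, rainbow by rainbow
  have hlin : ∀ Y, (∑ σ ∈ F.sup, (if σ.2 = S then
        (∑ R' ∈ (Sᶜ).powerset, (if F.lab R' = 0 ∧ (σ.1 ∪ σ.2)ᶜ ⊆ R' ∧ R' ⊆ Y then (1 : ZMod 2) else 0)) *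
          (∑ i : ↥R, g i * F.rbVec i.1 σ) else 0))
      = ∑ i : ↥R, g i * ∑ σ ∈ F.sup, (if σ.2 = S then
        (∑ R' ∈ (Sᶜ).powerset, (if F.lab R' = 0 ∧ (σ.1 ∪ σ.2)ᶜ ⊆ R' ∧ R' ⊆ Y then (1 : ZMod 2) else 0)) * F.rbVec i.1 σ
        else 0) := by
    intro Y
    rw [show (∑ i : ↥R, g i * ∑ σ ∈ F.sup, (if σ.2 = S then
          (∑ R' ∈ (Sᶜ).powerset, (if F.lab R' = 0 ∧ (σ.1 ∪ σ.2)ᶜ ⊆ R' ∧ R' ⊆ Y then (1 : ZMod 2) else 0)) * F.rbVec i.1 σ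
          else 0))
        = ∑ i : ↥R, ∑ σ ∈ F.sup, g i * (if σ.2 = S then
          (∑ R' ∈ (Sᶜ).powerset, (if F.lab R' = 0 ∧ (σ.1 ∪ σ.2)ᶜ ⊆ R' ∧ R' ⊆ Y then (1 : ZMod 2) else 0)) * F.rbVec i.1 σ
          else 0) from sum_congr rfl fun i _ => Finset.mul_sum _ _ _]
    rw [Finset.sum_comm]
    refine sum_congr rfl fun σ _ => ?_
    by_cases h : σ.2 = S
    · rw [if_pos h, Finset.mul_sum]
      refine sum_congr rfl fun i _ => ?_
      rw [if_pos h]; ring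
    · rw [if_neg h]
      symm
      exact sum_eq_zero fun i _ => by rw [if_neg h, mul_zero]
  -- the functional applied to the dependency vanishes
  have hzero : (∑ i : ↥R, g i * ((if F.lab S = 0 ∧ S ⊆ (i.1.1 ∪ i.1.2)ᶜ ∧ F.lab (Sᶜ \ i.1.1) = 4 then
          (∑ R' ∈ (Finset.univ : Finset α).powerset, (if F.lab R' = 0 ∧ S ⊆ R' ∧ R' ⊆ (i.1.1 ∪ i.1.2)ᶜ then (1 : ZMod 2) else 0))
          else 0) * (if s.1.1 ⊆ i.1.1 then 1 else 0))) = 0 := by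
    rw [show (∑ i : ↥R, g i * ((if F.lab S = 0 ∧ S ⊆ (i.1.1 ∪ i.1.2)ᶜ ∧ F.lab (Sᶜ \ i.1.1) = 4 then
          (∑ R' ∈ (Finset.univ : Finset α).powerset, (if F.lab R' = 0 ∧ S ⊆ R' ∧ R' ⊆ (i.1.1 ∪ i.1.2)ᶜ then (1 : ZMod 2) else 0))
          else 0) * (if s.1.1 ⊆ i.1.1 then 1 else 0)))
        = ∑ i : ↥R, ∑ Y ∈ (Sᶜ \ s.1.1).powerset, g i * (if F.lab (Sᶜ \ Y) = 4 then
            ∑ σ ∈ F.sup, (if σ.2 = S then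
              (∑ R' ∈ (Sᶜ).powerset, (if F.lab R' = 0 ∧ (σ.1 ∪ σ.2)ᶜ ⊆ R' ∧ R' ⊆ Y then (1 : ZMod 2) else 0)) * F.rbVec i.1 σ
              else 0) else 0) from
      sum_congr rfl fun i _ => by rw [← hread i, Finset.mul_sum]]
    rw [Finset.sum_comm]
    refine sum_eq_zero fun Y _ => ?_
    by_cases hY4 : F.lab (Sᶜ \ Y) = 4
    · rw [show (∑ i : ↥R, g i * (if F.lab (Sᶜ \ Y) = 4 then
            ∑ σ ∈ F.sup, (if σ.2 = S then
              (∑ R' ∈ (Sᶜ).powerset, (if F.lab R' = 0 ∧ (σ.1 ∪ σ.2)ᶜ ⊆ R' ∧ R' ⊆ Y then (1 : ZMod 2) else 0)) * F.rbVec i.1 σ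
              else 0) else 0))
          = ∑ i : ↥R, g i * ∑ σ ∈ F.sup, (if σ.2 = S then
              (∑ R' ∈ (Sᶜ).powerset, (if F.lab R' = 0 ∧ (σ.1 ∪ σ.2)ᶜ ⊆ R' ∧ R' ⊆ Y then (1 : ZMod 2) else 0)) * F.rbVec i.1 σ
              else 0) from sum_congr rfl fun i _ => by rw [if_pos hY4]]
      rw [← hlin Y]
      refine sum_eq_zero fun σ hσ => ?_
      by_cases h : σ.2 = S
      · rw [if_pos h, hsum σ hσ h, mul_zero]
      · rw [if_neg h]
    · exact sum_eq_zero fun i _ => by rw [if_neg hY4, mul_zero]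
  -- only `ρ*` survives (maximality of `|Q1|` and distinctness of the `Q1`)
  rw [← Finset.sum_erase_add _ _ (mem_univ s)] at hzero
  rw [show (∑ i ∈ (Finset.univ : Finset ↥R).erase s, g i * ((if F.lab S = 0 ∧ S ⊆ (i.1.1 ∪ i.1.2)ᶜ ∧ F.lab (Sᶜ \ i.1.1) = 4 then
          (∑ R' ∈ (Finset.univ : Finset α).powerset, (if F.lab R' = 0 ∧ S ⊆ R' ∧ R' ⊆ (i.1.1 ∪ i.1.2)ᶜ then (1 : ZMod 2) else 0))
          else 0) * (if s.1.1 ⊆ i.1.1 then 1 else 0))) = 0 from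
    sum_eq_zero fun i hi => by
      by_cases hgi : g i = 0
      · rw [hgi, zero_mul]
      · have hiT : i ∈ (Finset.univ : Finset ↥R).filter (fun i => g i ≠ 0) := mem_filter.2 ⟨mem_univ _, hgi⟩
        have hPi : ¬ s.1.1 ⊆ i.1.1 := by
          intro hPi
          have heq : i.1.1 = s.1.1 := (Finset.eq_of_subset_of_card_le hPi (hmax i hiT)).symm
          exact (mem_erase.1 hi).1 (Subtype.ext (hinj i.1 i.2 s.1 s.2 heq))
        rw [if_neg hPi, mul_zero, mul_zero], zero_add] at hzero
  rw [if_pos ⟨hS0, hSs, hS4⟩, hPhi, if_pos (subset_refl _), mul_one, mul_one] at hzero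
  exact hgs hzero

/-! ## The class theorem -/

/-- **★ FOR SUNFLOWERS WITH A GOOD LOCAL ASSIGNMENT** (this work; unconditional).  Suppose every rainbow `ρ = (Q1,Q2,Q3)` is assigned a block
`f ρ` which is EITHER a rival-free bottom slot of `ρ` (`lab (f ρ) = 0`, `f ρ ⊆ Q3`, `lab ((f ρ)ᶜ ∖ Q1) = 4`, `#{R' ∈ B : f ρ ⊆ R' ⊆ Q3}` odd, no
label-1 `T ⊆ (f ρ)ᶜ ∖ Q1` with `lab ((f ρ)ᶜ ∖ T) = 4`) OR a kernel block (`lab (f ρ) = 4`) carrying a supply where `rbVec ρ ≠ 0` and the vectors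
of all other rainbows assigned to that block vanish, and suppose rainbows assigned to the same bottom block have distinct `Q1`.  Then `0 ≤ ZH`. [this work] -/
theorem ZH_nonneg_of_goodAssignment (f : Finset α × Finset α → Finset α)
    (hgood : ∀ ρ ∈ F.dem.filter (fun d => F.IsRainbow d),
      (F.lab (f ρ) = 0 ∧ f ρ ⊆ (ρ.1 ∪ ρ.2)ᶜ ∧ F.lab ((f ρ)ᶜ \ ρ.1) = 4 ∧
        (∑ R' ∈ (Finset.univ : Finset α).powerset, (if F.lab R' = 0 ∧ f ρ ⊆ R' ∧ R' ⊆ (ρ.1 ∪ ρ.2)ᶜ then (1 : ZMod 2) else 0)) = 1 ∧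
        ∀ T, T ⊆ (f ρ)ᶜ \ ρ.1 → F.lab T = 1 → F.lab ((f ρ)ᶜ \ T) ≠ 4) ∨
      (F.lab (f ρ) = 4 ∧ ∃ σ ∈ F.sup, σ.2 = f ρ ∧ F.rbVec ρ σ ≠ 0 ∧
        ∀ ρ' ∈ F.dem.filter (fun d => F.IsRainbow d), f ρ' = f ρ → ρ' ≠ ρ → F.rbVec ρ' σ = 0))
    (hinj : ∀ ρ ∈ F.dem.filter (fun d => F.IsRainbow d), ∀ ρ' ∈ F.dem.filter (fun d => F.IsRainbow d),
      f ρ = f ρ' → F.lab (f ρ) = 0 → ρ.1 = ρ'.1 → ρ = ρ') :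
    0 ≤ F.ZH := by
  classical
  refine F.ZH_nonneg_of_blockAssignment f (fun ρ hρ => ?_) (fun S hS => ?_)
  · rcases hgood ρ hρ with h | h
    · exact Or.inr h.1
    · exact Or.inl h.1
  · rcases hS with hS4 | hS0
    · -- kernel block: private supplies
      refine F.blockIndependent_of_private S _ fun ρ hρ => ?_
      obtain ⟨hρr, hρS⟩ := mem_filter.1 hρ
      rcases hgood ρ hρr with h | h
      · rw [hρS, hS4] at h; exact absurd h.1 (by decide)
      · obtain ⟨-, σ, hσ, hσS, hnz, hoth⟩ := h
        refine ⟨σ, hσ, by rw [hσS, hρS], hnz, fun ρ' hρ' hne => ?_⟩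
        obtain ⟨hρ'r, hρ'S⟩ := mem_filter.1 hρ'
        exact hoth ρ' hρ'r (by rw [hρ'S, hρS]) hne
    · -- bottom block: rival-free slots with distinct `Q1`
      refine F.blockIndependent_of_rivalFree hS0 _ (Finset.filter_subset _ _) (fun ρ hρ => ?_) (fun ρ hρ ρ' hρ' heq => ?_)
      · obtain ⟨hρr, hρS⟩ := mem_filter.1 hρ
        rcases hgood ρ hρr with h | h
        · obtain ⟨-, h2, h3, h4, h5⟩ := h
          rw [hρS] at h2 h3 h4 h5
          exact ⟨h2, h3, h4, h5⟩
        · rw [hρS, hS0] at h; exact absurd h.1 (by decide)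
      · obtain ⟨hρr, hρS⟩ := mem_filter.1 hρ
        obtain ⟨hρ'r, hρ'S⟩ := mem_filter.1 hρ'
        exact hinj ρ hρr ρ' hρ'r (by rw [hρS, hρ'S]) (by rw [hρS]; exact hS0) heq

end Sunflower

end Summit.CriticalPhenomena.PercolationContinuityZ3.Theorems.SunflowerPartition
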